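import Mathlib.InformationTheory.KullbackLeibler.Basic
import Mathlib.Analysis.Convex.Integral
import Mathlib.Analysis.SpecialFunctions.Log.NegMulLog
import Mathlib.MeasureTheory.Integral.Prod
import Mathlib.MeasureTheory.Integral.IntervalIntegral.Basic
import HarnessLib

/-!
# Exact entropy-ball duality with a Krylov–Bogoliubov witness — abstract helpers

Helper file (`--supports stmt-AtomisticToContinuum-13915`) for the registered stub
`stub_entropyBallDuality : TorusGibbsInvariance → EntropyBallDuality` of the line
`entropy-ball-invariant-states` of the crux
`Summit.AtomisticToContinuum.HydrodynamicLimit.Theses.AntiMazurCoboundaries.CellForecastPressureDecay`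
(stmt-AtomisticToContinuum-13915, route `AntiMazurCoboundaries`), proved in the sibling file
`AntiMazurCoboundariesCellForecastPressureDecayEntropyBallDuality.lean` (abstract theorem
`Duality.exists_klDiv_witness` + instantiation). Everything here is ABSTRACT measure theory on a
measurable space `Ω` with a finite (or probability) measure `G` and a jointly measurable map
`φ : ℝ → Ω → Ω`; no hard-sphere object enters.

* Bookkeeping on the time window `Ioc 0 τ`: Fubini measurability of partial integrals
  (`measurable_setIntegral_left`, `measurable_integral_right`), Fubini for bounded jointly
  measurable integrands (`integral_setIntegral_swap`), window averages of functions with values in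
  `[a₀, b₀]` stay in `[a₀, b₀]` (`windowAvg_mem_Icc`).
* `mul_log_windowAvg_le` — POINTWISE Jensen for `x log x` on a window average
  (`Real.convexOn_mul_log`, `ConvexOn.map_set_average_le`): the only place entropy is lost.
* `abs_windowAvg_shift_sub_le` — the Krylov–Bogoliubov almost-invariance estimate
  `|τ⁻¹∫₀^τ h(s+t) dt − τ⁻¹∫₀^τ h(t) dt| ≤ 2s/τ` for `0 ≤ h ≤ 1`.
* `integral_mul_windowAvg_comp_neg` — the transport identity of the Krylov–Bogoliubov average:
  for bounded measurable `F, Ψ`, a `G`-preserving `φ` with `φ_{-t} ∘ φ_t = id`,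
  `∫ F(z) · (τ⁻¹∫₀^τ Ψ(φ_{-t} z) dt) dG = τ⁻¹ ∫₀^τ ∫ F(φ_t w) Ψ(w) dG dt` (Fubini + invariance).
* `stub_entropyBallDualityDensityKL` (registered sub-goal) — for a measurable density `0 < m ≤ ρ ≤ M` with `∫ ρ dG = 1`,
  `ρ · G` is a probability measure and `KL(ρ·G | G) = ∫ ρ log ρ dG < ∞`
  (`Measure.rnDeriv_withDensity`, `InformationTheory.toReal_klDiv_of_measure_eq`).

References: C. Kipnis, C. Landim, *Scaling Limits of Interacting Particle Systems* (1999), App. 1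
§8; A. Dembo, O. Zeitouni, *Large Deviations Techniques and Applications* (2010), §6.2.
-/

noncomputable section

open MeasureTheory Set Filter InformationTheory
open scoped ENNReal

namespace Summit.AtomisticToContinuum.HydrodynamicLimit.Theorems.EntropyBall.Duality

variable {Ω : Type*} [MeasurableSpace Ω]

/-! ## Bounded measurable bookkeeping -/

/-- Partial integrals over a time window of a jointly measurable integrand are measurable in the
phase-space variable (Fubini measurability). -/
theorem measurable_setIntegral_left {g : ℝ × Ω → ℝ} (hg : Measurable g) (S : Set ℝ) :
    Measurable fun z => ∫ t in S, g (t, z) :=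
  (hg.stronglyMeasurable.integral_prod_left' (μ := volume.restrict S)).measurable

/-- Phase-space integrals of a jointly measurable integrand are measurable in time. -/
theorem measurable_integral_right {g : ℝ × Ω → ℝ} (hg : Measurable g) (G : Measure Ω)
    [SFinite G] : Measurable fun t => ∫ z, g (t, z) ∂G :=
  (hg.stronglyMeasurable.integral_prod_right' (ν := G)).measurable

/-- Fubini for a bounded jointly measurable integrand on `(window) × (finite measure)`. -/
theorem integral_setIntegral_swap (G : Measure Ω) [IsFiniteMeasure G] {g : ℝ → Ω → ℝ}
    (hg : Measurable (Function.uncurry g)) {K : ℝ} (hK : ∀ t z, |g t z| ≤ K) (a b : ℝ) :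
    ∫ z, (∫ t in Ioc a b, g t z) ∂G = ∫ t in Ioc a b, (∫ z, g t z ∂G) := by
  refine integral_integral_swap (f := fun z t => g t z) ?_
  refine Integrable.of_bound ?_ K (ae_of_all _ fun p => ?_)
  · exact (hg.comp (measurable_snd.prodMk measurable_fst)).aestronglyMeasurable
  · show ‖g p.2 p.1‖ ≤ K
    rw [Real.norm_eq_abs]
    exact hK p.2 p.1

/-- A bounded measurable function is integrable on every window `Ioc a b`. -/
theorem integrableOn_Ioc_of_bdd {h : ℝ → ℝ} (hhm : Measurable h) {a₀ b₀ : ℝ}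
    (ha : ∀ t, a₀ ≤ h t) (hb : ∀ t, h t ≤ b₀) (a b : ℝ) : IntegrableOn h (Ioc a b) :=
  IntegrableOn.of_bound measure_Ioc_lt_top hhm.aestronglyMeasurable (max |a₀| |b₀|)
    (ae_of_all _ fun t => by rw [Real.norm_eq_abs]; exact abs_le_max_abs_abs (ha t) (hb t))

/-- The window average `τ⁻¹ ∫₀^τ h` of a measurable `h` with values in `[a₀, b₀]` lies in
`[a₀, b₀]`. -/
theorem windowAvg_mem_Icc {h : ℝ → ℝ} (hhm : Measurable h) {a₀ b₀ : ℝ} (ha : ∀ t, a₀ ≤ h t)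
    (hb : ∀ t, h t ≤ b₀) {τ : ℝ} (hτ : 0 < τ) :
    τ⁻¹ * ∫ t in Ioc 0 τ, h t ∈ Icc a₀ b₀ := by
  have hint : IntegrableOn h (Ioc 0 τ) := integrableOn_Ioc_of_bdd hhm ha hb 0 τ
  have hvol : (volume : Measure ℝ).real (Ioc 0 τ) = τ := by
    rw [Real.volume_real_Ioc_of_le hτ.le, sub_zero]
  have h1 : ∫ _ in Ioc 0 τ, a₀ ≤ ∫ t in Ioc 0 τ, h t :=
    integral_mono (integrable_const a₀) hint ha
  have h2 : ∫ t in Ioc 0 τ, h t ≤ ∫ _ in Ioc 0 τ, b₀ :=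
    integral_mono hint (integrable_const b₀) hb
  rw [setIntegral_const, hvol, smul_eq_mul] at h1 h2
  constructor
  · rw [le_inv_mul_iff₀ hτ]; linarith
  · rw [inv_mul_le_iff₀ hτ]; linarith

/-- **Pointwise Jensen for `x log x` on a window average**: for measurable `h` with values in
`[m, M]`, `m > 0`, `(τ⁻¹∫₀^τ h) log (τ⁻¹∫₀^τ h) ≤ τ⁻¹ ∫₀^τ h log h`. -/
theorem mul_log_windowAvg_le {h : ℝ → ℝ} (hhm : Measurable h) {m M : ℝ} (hm : 0 < m)
    (hhm' : ∀ t, m ≤ h t) (hhM : ∀ t, h t ≤ M) {τ : ℝ} (hτ : 0 < τ) :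
    (τ⁻¹ * ∫ t in Ioc 0 τ, h t) * Real.log (τ⁻¹ * ∫ t in Ioc 0 τ, h t) ≤
      τ⁻¹ * ∫ t in Ioc 0 τ, h t * Real.log (h t) := by
  have hvol : (volume : Measure ℝ).real (Ioc 0 τ) = τ := by
    rw [Real.volume_real_Ioc_of_le hτ.le, sub_zero]
  have h0 : (volume : Measure ℝ) (Ioc 0 τ) ≠ 0 := by
    rw [Real.volume_Ioc, sub_zero]; exact (ENNReal.ofReal_pos.2 hτ).ne'
  have htop : (volume : Measure ℝ) (Ioc 0 τ) ≠ ∞ := measure_Ioc_lt_top.ne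
  -- bounds on `log h` and `h log h`
  have hlog : ∀ t, |Real.log (h t)| ≤ max |Real.log m| |Real.log M| := fun t =>
    abs_le_max_abs_abs (Real.log_le_log hm (hhm' t))
      (Real.log_le_log (hm.trans_le (hhm' t)) (hhM t))
  set K : ℝ := max |m| |M| * max |Real.log m| |Real.log M| with hK
  have hprod : ∀ t, |h t * Real.log (h t)| ≤ K := fun t => by
    rw [abs_mul]
    exact mul_le_mul (abs_le_max_abs_abs (hhm' t) (hhM t)) (hlog t) (abs_nonneg _)
      ((abs_nonneg _).trans (le_max_left _ _))
  have hfi : IntegrableOn h (Ioc 0 τ) := integrableOn_Ioc_of_bdd hhm hhm' hhM 0 τ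
  have hgi : IntegrableOn ((fun x => x * Real.log x) ∘ h) (Ioc 0 τ) :=
    integrableOn_Ioc_of_bdd (hhm.mul (Real.measurable_log.comp hhm))
      (fun t => (abs_le.1 (hprod t)).1) (fun t => (abs_le.1 (hprod t)).2) 0 τ
  have hfs : ∀ᵐ t ∂(volume : Measure ℝ).restrict (Ioc 0 τ), h t ∈ Ici (0 : ℝ) :=
    ae_of_all _ fun t => (hm.le.trans (hhm' t) : (0 : ℝ) ≤ h t)
  have key := ConvexOn.map_set_average_le (μ := (volume : Measure ℝ)) (t := Ioc 0 τ) (f := h)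
    Real.convexOn_mul_log Real.continuous_mul_log.continuousOn isClosed_Ici h0 htop hfs hfi hgi
  simpa only [setAverage_eq, hvol, smul_eq_mul] using key

/-- **The almost-invariance estimate**: for measurable `h` with `0 ≤ h ≤ 1`, `τ > 0` and `s ≥ 0`,
`|τ⁻¹∫₀^τ h(s + t) dt − τ⁻¹∫₀^τ h(t) dt| = τ⁻¹ |∫_τ^{τ+s} h − ∫_0^s h| ≤ 2s/τ`. -/
theorem abs_windowAvg_shift_sub_le {h : ℝ → ℝ} (hhm : Measurable h) (h0 : ∀ u, 0 ≤ h u)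
    (h1 : ∀ u, h u ≤ 1) {τ : ℝ} (hτ : 0 < τ) {s : ℝ} (hs : 0 ≤ s) :
    |(τ⁻¹ * ∫ t in Ioc 0 τ, h (s + t)) - τ⁻¹ * ∫ t in Ioc 0 τ, h t| ≤ 2 * s / τ := by
  have hii : ∀ a b : ℝ, IntervalIntegrable h volume a b := fun a b =>
    (intervalIntegrable_const (c := (1 : ℝ))).mono_fun' hhm.aestronglyMeasurable
      (ae_of_all _ fun u => by
        show ‖h u‖ ≤ 1
        rw [Real.norm_eq_abs, abs_of_nonneg (h0 u)]; exact h1 u)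
  have hbd : ∀ a b : ℝ, |∫ u in a..b, h u| ≤ |b - a| := fun a b => by
    have := intervalIntegral.norm_integral_le_of_norm_le_const (a := a) (b := b) (C := 1)
      (f := h) fun u _ => by rw [Real.norm_eq_abs, abs_of_nonneg (h0 u)]; exact h1 u
    rwa [one_mul, Real.norm_eq_abs] at this
  rw [← intervalIntegral.integral_of_le hτ.le, ← intervalIntegral.integral_of_le hτ.le,
    intervalIntegral.integral_comp_add_left h s, add_zero, ← mul_sub,
    intervalIntegral.integral_interval_sub_interval_comm (hii s (s + τ)) (hii 0 τ) (hii s 0),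
    abs_mul, abs_of_pos (inv_pos.2 hτ)]
  have hX : |(∫ u in s..0, h u) - ∫ u in s + τ..τ, h u| ≤ s + s := by
    refine (abs_sub _ _).trans (add_le_add ((hbd s 0).trans ?_) ((hbd (s + τ) τ).trans ?_))
    · rw [zero_sub, abs_neg, abs_of_nonneg hs]
    · rw [show τ - (s + τ) = -s by ring, abs_neg, abs_of_nonneg hs]
  calc τ⁻¹ * |(∫ u in s..0, h u) - ∫ u in s + τ..τ, h u| ≤ τ⁻¹ * (s + s) :=
        mul_le_mul_of_nonneg_left hX (inv_pos.2 hτ).le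
    _ = 2 * s / τ := by ring

/-- Indicator of a preimage: `𝟙_{g⁻¹B}(x) = 𝟙_B(g x)`. -/
theorem indicator_preimage_one {α β : Type*} (g : α → β) (B : Set β) (x : α) :
    (g ⁻¹' B).indicator (1 : α → ℝ) x = B.indicator (fun _ => (1 : ℝ)) (g x) := by
  by_cases hx : g x ∈ B
  · rw [Set.indicator_of_mem hx, Set.indicator_of_mem (Set.mem_preimage.2 hx), Pi.one_apply]
  · rw [Set.indicator_of_notMem hx,
      Set.indicator_of_notMem (fun h : x ∈ g ⁻¹' B => hx (Set.mem_preimage.1 h))]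

/-! ## Transport along a measure-preserving group -/

section Transport

variable {G : Measure Ω} {φ : ℝ → Ω → Ω}

/-- Each time slice of a jointly measurable flow is measurable. -/
theorem measurable_slice (hφm : Measurable fun p : ℝ × Ω => φ p.1 p.2) (t : ℝ) :
    Measurable (φ t) :=
  hφm.comp (measurable_const.prodMk measurable_id)

/-- Transport of integrals along a `G`-preserving measurable map: `∫ F ∘ φ_t dG = ∫ F dG`. -/
theorem integral_comp_of_map_eq {t : ℝ} (hφt : Measurable (φ t)) (hinv : G.map (φ t) = G)
    {F : Ω → ℝ} (hF : AEStronglyMeasurable F G) :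
    ∫ z, F (φ t z) ∂G = ∫ z, F z ∂G := by
  have h := integral_map (μ := G) hφt.aemeasurable (f := F) (by rwa [hinv])
  rw [hinv] at h
  exact h.symm

/-- **The transport identity of the Krylov–Bogoliubov average**: for bounded measurable `F, Ψ`,
`∫ F(z) · (τ⁻¹∫₀^τ Ψ(φ_{-t} z) dt) dG = τ⁻¹ ∫₀^τ ∫ F(φ_t w) Ψ(w) dG dt`
(Fubini, invariance of `G` under `φ_t`, and `φ_{-t} ∘ φ_t = id`). -/
theorem integral_mul_windowAvg_comp_neg (G : Measure Ω) [IsFiniteMeasure G]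
    (hφm : Measurable fun p : ℝ × Ω => φ p.1 p.2) (hneg : ∀ t w, φ (-t) (φ t w) = w)
    (hinv : ∀ t, G.map (φ t) = G) {F Ψ : Ω → ℝ} (hF : Measurable F) (hΨ : Measurable Ψ)
    {KF KΨ : ℝ} (hKF : ∀ z, |F z| ≤ KF) (hKΨ : ∀ z, |Ψ z| ≤ KΨ) (τ : ℝ) :
    ∫ z, F z * (τ⁻¹ * ∫ t in Ioc 0 τ, Ψ (φ (-t) z)) ∂G =
      τ⁻¹ * ∫ t in Ioc 0 τ, ∫ w, F (φ t w) * Ψ w ∂G := by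
  have hφt : ∀ t, Measurable (φ t) := measurable_slice hφm
  have h1 : ∀ z, F z * (τ⁻¹ * ∫ t in Ioc 0 τ, Ψ (φ (-t) z)) =
      τ⁻¹ * ∫ t in Ioc 0 τ, F z * Ψ (φ (-t) z) := fun z => by
    rw [integral_const_mul]; ring
  simp_rw [h1]
  rw [integral_const_mul]
  congr 1
  have hg : Measurable (Function.uncurry fun (t : ℝ) (z : Ω) => F z * Ψ (φ (-t) z)) :=
    (hF.comp measurable_snd).mul (hΨ.comp (hφm.comp (measurable_fst.neg.prodMk measurable_snd)))
  have hgK : ∀ (t : ℝ) (z : Ω), |F z * Ψ (φ (-t) z)| ≤ KF * KΨ := fun t z => by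
    rw [abs_mul]
    exact mul_le_mul (hKF _) (hKΨ _) (abs_nonneg _) ((abs_nonneg _).trans (hKF z))
  rw [integral_setIntegral_swap G hg hgK 0 τ]
  refine setIntegral_congr_fun measurableSet_Ioc fun t _ => ?_
  have hH : Measurable fun z => F z * Ψ (φ (-t) z) := hF.mul (hΨ.comp (hφt (-t)))
  rw [← integral_comp_of_map_eq (hφt t) (hinv t) hH.aestronglyMeasurable]
  simp only [hneg]

end Transport

/-! ## Relative entropy of a bounded density -/

/-- Integration against `ρ · G` for a nonnegative measurable real density `ρ`. -/
theorem integral_withDensity_ofReal (G : Measure Ω) {ρ : Ω → ℝ} (hρm : Measurable ρ)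
    (hρ0 : ∀ z, 0 ≤ ρ z) (g : Ω → ℝ) :
    ∫ z, g z ∂(G.withDensity fun z => ENNReal.ofReal (ρ z)) = ∫ z, ρ z * g z ∂G := by
  have hmeas : Measurable fun z => ENNReal.ofReal (ρ z) := ENNReal.measurable_ofReal.comp hρm
  rw [integral_withDensity_eq_integral_toReal_smul hmeas
    (Eventually.of_forall fun _ => ENNReal.ofReal_lt_top)]
  refine integral_congr_ae (ae_of_all _ fun z => ?_)
  simp only [ENNReal.toReal_ofReal (hρ0 z), smul_eq_mul]

/-- **Relative entropy of a density bounded away from `0` and `∞`** (registered sub-goal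
`stub_entropyBallDualityDensityKL` of the stub `stub_entropyBallDuality`): for measurable `ρ` with
`0 < m ≤ ρ ≤ M` and `∫ ρ dG = 1` on a probability space, `μ := ρ · G` is a probability measure,
`KL(μ | G)` is finite and `KL(μ | G) = ∫ ρ log ρ dG`. -/
theorem stub_entropyBallDualityDensityKL : ∀ (Ω : Type) [MeasurableSpace Ω] (G : MeasureTheory.Measure Ω)
    [MeasureTheory.IsProbabilityMeasure G] (ρ : Ω → ℝ) (m M : ℝ), Measurable ρ → 0 < m → (∀ z, m ≤ ρ z) →
    (∀ z, ρ z ≤ M) → ∫ z, ρ z ∂G = 1 →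
    MeasureTheory.IsProbabilityMeasure (G.withDensity fun z => ENNReal.ofReal (ρ z)) ∧
    InformationTheory.klDiv (G.withDensity fun z => ENNReal.ofReal (ρ z)) G ≠ ⊤ ∧
    (InformationTheory.klDiv (G.withDensity fun z => ENNReal.ofReal (ρ z)) G).toReal =
      ∫ z, ρ z * Real.log (ρ z) ∂G := by
  intro Ω _ G _ ρ m M hρm hm hρm' hρM h1
  set μ : Measure Ω := G.withDensity fun z => ENNReal.ofReal (ρ z) with hμ
  have hρ0 : ∀ z, 0 ≤ ρ z := fun z => hm.le.trans (hρm' z)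
  have hmeas : Measurable fun z => ENNReal.ofReal (ρ z) := ENNReal.measurable_ofReal.comp hρm
  have hμG : μ ≪ G := withDensity_absolutelyContinuous _ _
  have hρint : Integrable ρ G :=
    Integrable.of_bound hρm.aestronglyMeasurable (max |m| |M|)
      (ae_of_all _ fun z => by rw [Real.norm_eq_abs]; exact abs_le_max_abs_abs (hρm' z) (hρM z))
  have hprob : IsProbabilityMeasure μ := by
    refine ⟨?_⟩
    rw [hμ, withDensity_apply _ MeasurableSet.univ, Measure.restrict_univ,
      ← ofReal_integral_eq_lintegral_ofReal hρint (ae_of_all _ hρ0), h1, ENNReal.ofReal_one]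
  have hllrG : llr μ G =ᵐ[G] fun z => Real.log (ρ z) := by
    filter_upwards [Measure.rnDeriv_withDensity G hmeas] with z hz
    simp only [MeasureTheory.llr, hμ]
    rw [hz, ENNReal.toReal_ofReal (hρ0 z)]
  have hllrμ : llr μ G =ᵐ[μ] fun z => Real.log (ρ z) := hμG.ae_eq hllrG
  have hlog : ∀ z, |Real.log (ρ z)| ≤ max |Real.log m| |Real.log M| := fun z =>
    abs_le_max_abs_abs (Real.log_le_log hm (hρm' z))
      (Real.log_le_log (hm.trans_le (hρm' z)) (hρM z))
  have hint : Integrable (llr μ G) μ := by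
    refine Integrable.congr ?_ hllrμ.symm
    exact Integrable.of_bound (Real.measurable_log.comp hρm).aestronglyMeasurable _
      (ae_of_all _ fun z => by rw [Real.norm_eq_abs]; exact hlog z)
  refine ⟨hprob, klDiv_ne_top hμG hint, ?_⟩
  rw [toReal_klDiv_of_measure_eq hμG (by simp), integral_congr_ae hllrμ, hμ,
    integral_withDensity_ofReal G hρm hρ0]

end Summit.AtomisticToContinuum.HydrodynamicLimit.Theorems.EntropyBall.Duality

end
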